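import Literature.MathematicalPhysics.QuantumFieldTheory.Balaban1983to89.B14BoxFix

/-!
# `Balaban1983to89.B14Eq21Admissible` — CMP 119 (2.1)–(2.3) pp. 254–255: the ADMISSIBLE SEQUENCES OF DOMAINS
# `{Ω_j}, {Λ_j}, {S_j}` of the inductive description, as a predicate WITH BODY on pv02's cube carrier
# (`B14DomainGeom`), the large field regions `Z_j = Λ_jᶜ` with the condition (2.3) (`B14BoxFix.Cond23`), and the
# regions `R_j`; the printed set identity `Ω_j ∖ Ω_j^{∼−1} = Ω_j ∩ (Ω_jᶜ)^∼` PROVED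

statement-level skeleton of published theorems with citation tags; proofs where landed; nothing here is a claim about the Yang–Mills mass gap

CITATION HEADER (lean-in-tree rule).  Source: T. Bałaban, *Convergent renormalization expansions for lattice gauge
theories*, Commun. Math. Phys. **119**, 243–285 (1988), doi:10.1007/bf01217741 [Balaban1988Convergent] (cell paper
B14 = «[III]»; held `paper:balaban1988-cmp119-convergent-renormalization`, journal page = PDF page + 242; pp. 254–256
read on the x2 renders `…-p012-x2.png`, `…-p013-x2.png` and the text layer `p0012`–`p0014`).  Mega-formalization
`lit-balaban`, unit `lit-balaban-r11` (CMP 119, B14 fold owner), SKELETON rows **B14.Eq2.1** ((2.1) + {S_j}),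
**B14.Eq2.3** (Z_j = Λ_jᶜ and its parallelepiped condition — the condition itself and the replacement rule securing it
are pv02's `B14BoxFix`, used BY NAME), B14.Def§2.p256 (the cube classes).

THE PRINTED TEXT (pp. 254–255 [PDF 12–13], verbatim).  *"We consider sequences of localization domains {Ω_j},
j = 1, 2, …, k, Ω_j ∈ 𝐃_j, such that Ω₁ ⊃ Ω₂ ⊃ … ⊃ Ω_k. For such a sequence we consider sequences of localization domains
{Λ_j}, Λ_j ∈ 𝐃_j, such that
  Ω₁ ⊃ Λ₁ ⊃ Ω₂ ⊃ Λ₂ ⊃ … ⊃ Ω_j ⊃ Λ_j ⊃ … ⊃ Ω_k ⊃ Λ_k.   (2.1)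
We consider also a third family of sequences {S_j}, j = 1, 2, …, k, where S_j ⊂ Ω_j ∩ Λ_jᶜ, and S_j is either empty, or
it is a union of LM₂R_j-cubes in the lattice T_{L^{−j}}. For the domains in (2.1) we admit the possibility that Λ_j = Ω_j
for some indices j. Such a situation may arise as a result of an R-operation. If Ω_j ∩ Λ_jᶜ is nonempty, then S_j is
nonempty too; in fact it contains Ω_j ∖ Ω_j^{∼−1} = Ω_j ∩ (Ω_jᶜ)^∼. There is a characteristic function χ(Ω_j ∩ Λ_jᶜ, S_j)
associated with these domains, which includes a large fluctuation field characteristic function associated with the set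
R_j = S_j ∖ (Ω_j ∩ (Ω_jᶜ)^∼). There is also a function ζ(Ω_jᶜ) … These functions were defined in the first step, and
their inductive definition will be given in the next section"*; and p. 255: *"We denote further Z_j = Λ_jᶜ. (2.3) These
large field regions satisfy the following condition: if a component of Z_j is contained in a cube of the size 100MR_j
(in the L^{−j}-lattice), then it is a rectangular parallelepiped."*  (p. 256: *"The domains Ω_j, Λ_j, which are
determined by the j-th renormalization transformation, but not by the R-operation, are unions of MR_j-cubes in the
lattice T_{L^{−j}}."*)

THE CARRIER (pre-existing, BY NAME).  Points `B14DomainGeom.Pt d = ℤᵈ` (sites of the fine lattice), cubes of side `s`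
through `cubeIdx s`, `IsUnionOfCubes s`, one layer of side-`s` cubes added/removed `enl s 1` / `innerN s 1` (print's
`X^∼`, `X^{∼−1}`); the (2.3) condition on a set of cube INDICES `B14BoxFix.Cond23 N` (touching components `tComp`,
`FitsIn`, `IsBox`).  The scale-dependent cube sides enter as PARAMETERS (READING RULE (a): printed objects as
parameters): `sT j` = the side of the cubes of the `∼`-operation at scale `j`, `sS j` = the side of the `LM₂R_j`-cubes,
`sZ j` = the side of the `MR_j`-cubes, all in units of the carrier lattice; the classes `𝐃_j` of localization domains
enter as the datum `D : ℕ → Set (Set (Pt d))`.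

WHAT IS TYPED / PROVED (0 `sorry`; the `Prop`-structures are PREDICATES on the sequence data, no named fact).
§1  **`Adm21 D sT sS k Ω Λ S`** — (2.1) and the `{S_j}` clauses verbatim: `Ω_j, Λ_j ∈ 𝐃_j`; the chain (2.1) as
    `Λ_j ⊆ Ω_j` (*"we admit the possibility that Λ_j = Ω_j"*) and `Ω_{j+1} ⊆ Λ_j`; `S_j ⊆ Ω_j ∩ Λ_jᶜ`; `S_j` a union of
    `sS j`-cubes (the empty set is one); and the requirement *"If Ω_j ∩ Λ_jᶜ is nonempty, then … it contains
    Ω_j ∖ Ω_j^{∼−1}"* (`S_layer`).  `Z Λ j = (Λ j)ᶜ` (2.3) and **`Adm23 sZ k Λ`** = the printed condition on `Z_j` via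
    `B14BoxFix.Cond23 100` on the `MR_j`-cube indices of `Z_j`; `Admissible` = both.  `R Ω S sT j` = the regions `R_j`.
§2  PROVED: the printed identity **`sdiff_innerN_eq`** (`Ω ∖ Ω^{∼−1} = Ω ∩ (Ωᶜ)^∼`, from pv02's
    `innerN_eq_compl_enl_compl`), hence `R_eq` (the two forms of `R_j`); the chain consequences `Ω_antitone`,
    `Λ_antitone` (via `Ω_add_subset`/`Λ_add_subset`), `Λ_subset_Ω_of_le`, `Z_monotone` (*"Ω₁ ⊃ Ω₂ ⊃ … ⊃ Ω_k"*, `Z₁ ⊆ Z₂ ⊆ …`); `S_nonempty` (*"then S_j is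
    nonempty too"* — given a point of `Ω_j` outside `Ω_j^{∼−1}`, which print takes for granted); `R_subset`,
    `disjoint_R_layer`; the degenerate case `of_eq` (`Λ_j = Ω_j`, `S_j = ∅` for all `j`: admissible iff the `Ω_j` are a
    chain in `𝐃_j` — *"Such a situation may arise as a result of an R-operation"*).

NOT ASSERTED: how the sequences are PRODUCED (§3 and [B15]/[B16]), the p. 256 boundary-distance conditions (*"e.g., the
distance between their boundaries is at least equal to 2MR_j, which will be determined inductively"*, row B14.Def§2.p256),
the characteristic functions `χ`, `ζ` (rows B14.Eq2.16–2.17, B14.Eq1.11), the replacement rule behind (2.3) (row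
B14.Eq2.3: `B14BoxFix.cond23_iterate`, `single_pass_fails`).

## References
* [Balaban1988Convergent] T. Bałaban, Commun. Math. Phys. 119 (1988) 243–285, (2.1)–(2.3) pp. 254–256.
-/

namespace Literature.MathematicalPhysics.QuantumFieldTheory.Balaban1983to89.B14.Eq21Admissible

open Literature.MathematicalPhysics.QuantumFieldTheory.Balaban1983to89
open B14DomainGeom B14Components B14BoxFix

variable {d : ℕ}

/-! ## §1. The predicates -/

/-- **(2.1) + the `{S_j}` clauses, pp. 254–255** — admissibility of the sequences `{Ω_j}, {Λ_j}, {S_j}`, `j = 1, …, k`: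
*"Ω_j ∈ 𝐃_j … Λ_j ∈ 𝐃_j, such that Ω₁ ⊃ Λ₁ ⊃ Ω₂ ⊃ Λ₂ ⊃ … ⊃ Ω_k ⊃ Λ_k (2.1) … S_j ⊂ Ω_j ∩ Λ_jᶜ, and S_j is either
empty, or it is a union of LM₂R_j-cubes … we admit the possibility that Λ_j = Ω_j … If Ω_j ∩ Λ_jᶜ is nonempty, then
S_j … contains Ω_j ∖ Ω_j^{∼−1}"*.  Data: the classes `D j = 𝐃_j`, the cube sides `sT j` (of `∼`) and `sS j` (of the
`LM₂R_j`-cubes), the top index `k`, the three sequences (values at `j = 0` and `j > k` are ignored). [cite: Balaban1988Convergent, (2.1) pp.254–255] -/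
structure Adm21 (D : ℕ → Set (Set (Pt d))) (sT sS : ℕ → ℕ) (k : ℕ) (Ω Λ S : ℕ → Set (Pt d)) : Prop where
  memΩ : ∀ j, 1 ≤ j → j ≤ k → Ω j ∈ D j
  memΛ : ∀ j, 1 ≤ j → j ≤ k → Λ j ∈ D j
  Λ_subset : ∀ j, 1 ≤ j → j ≤ k → Λ j ⊆ Ω j
  Ω_succ_subset : ∀ j, 1 ≤ j → j < k → Ω (j + 1) ⊆ Λ j
  S_subset : ∀ j, 1 ≤ j → j ≤ k → S j ⊆ Ω j ∩ (Λ j)ᶜ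
  S_cubes : ∀ j, 1 ≤ j → j ≤ k → IsUnionOfCubes (sS j) (S j)
  S_layer : ∀ j, 1 ≤ j → j ≤ k → (Ω j ∩ (Λ j)ᶜ).Nonempty → Ω j \ innerN (sT j) 1 (Ω j) ⊆ S j

/-- (2.3) `Z_j = Λ_jᶜ`, the large field regions. [cite: Balaban1988Convergent, (2.3) p.255] -/
def Z (Λ : ℕ → Set (Pt d)) (j : ℕ) : Set (Pt d) := (Λ j)ᶜ

/-- Unfolding of `Z`. [cite: Balaban1988Convergent, (2.3) p.255] -/
@[simp] theorem mem_Z {Λ : ℕ → Set (Pt d)} {j : ℕ} {x : Pt d} : x ∈ Z Λ j ↔ x ∉ Λ j := Iff.rfl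

/-- The set of INDICES of the `MR_j`-cubes (side `sZ j`) meeting `Z_j` — the carrier on which `B14BoxFix.Cond23` reads
*"a component of Z_j"* (touching components of cubes). [cite: Balaban1988Convergent, (2.3) p.255] -/
def ZIdx (sZ : ℕ → ℕ) (Λ : ℕ → Set (Pt d)) (j : ℕ) : Set (Pt d) := cubeIdx (sZ j) '' Z Λ j

/-- **The condition (2.3) on the large field regions**, p. 255: *"if a component of Z_j is contained in a cube of the
size 100MR_j (in the L^{−j}-lattice), then it is a rectangular parallelepiped"* — `B14BoxFix.Cond23 100` on the cube
indices of `Z_j`, for `j = 1, …, k`. [cite: Balaban1988Convergent, (2.3) p.255] -/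
structure Adm23 (sZ : ℕ → ℕ) (k : ℕ) (Λ : ℕ → Set (Pt d)) : Prop where
  cond23 : ∀ j, 1 ≤ j → j ≤ k → Cond23 100 (ZIdx sZ Λ j)

/-- Admissible sequences of the inductive description: (2.1) with the `{S_j}` clauses AND the condition (2.3). [cite: Balaban1988Convergent, (2.1)–(2.3) pp.254–255] -/
structure Admissible (D : ℕ → Set (Set (Pt d))) (sT sS sZ : ℕ → ℕ) (k : ℕ) (Ω Λ S : ℕ → Set (Pt d)) : Prop where
  adm21 : Adm21 D sT sS k Ω Λ S
  adm23 : Adm23 sZ k Λ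

/-- The regions `R_j = S_j ∖ (Ω_j ∩ (Ω_jᶜ)^∼)` carrying the large fluctuation field characteristic functions (p. 255).
[cite: Balaban1988Convergent, §2 p.255] -/
def R (Ω S : ℕ → Set (Pt d)) (sT : ℕ → ℕ) (j : ℕ) : Set (Pt d) := S j \ (Ω j ∩ enl (sT j) 1 (Ω j)ᶜ)

/-! ## §2. Printed sentences PROVED -/

/-- **p. 255: `Ω ∖ Ω^{∼−1} = Ω ∩ (Ωᶜ)^∼`** (one layer of side-`s` cubes). [cite: Balaban1988Convergent, §2 p.255] -/
theorem sdiff_innerN_eq (s : ℕ) (Ω : Set (Pt d)) : Ω \ innerN s 1 Ω = Ω ∩ enl s 1 Ωᶜ := by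
  rw [innerN_eq_compl_enl_compl, Set.sdiff_eq, compl_compl]

/-- Hence the two forms of `R_j`: `S_j ∖ (Ω_j ∩ (Ω_jᶜ)^∼) = S_j ∖ (Ω_j ∖ Ω_j^{∼−1})`. [cite: Balaban1988Convergent, §2 p.255] -/
theorem R_eq (Ω S : ℕ → Set (Pt d)) (sT : ℕ → ℕ) (j : ℕ) :
    R Ω S sT j = S j \ (Ω j \ innerN (sT j) 1 (Ω j)) := by
  rw [R, sdiff_innerN_eq]

/-- `R_j ⊆ S_j`. [cite: Balaban1988Convergent, §2 p.255] -/
theorem R_subset (Ω S : ℕ → Set (Pt d)) (sT : ℕ → ℕ) (j : ℕ) : R Ω S sT j ⊆ S j := Set.sdiff_subset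

/-- `R_j` is disjoint from the boundary layer `Ω_j ∖ Ω_j^{∼−1}`. [cite: Balaban1988Convergent, §2 p.255] -/
theorem disjoint_R_layer (Ω S : ℕ → Set (Pt d)) (sT : ℕ → ℕ) (j : ℕ) :
    Disjoint (R Ω S sT j) (Ω j \ innerN (sT j) 1 (Ω j)) := by
  rw [R_eq]; exact Set.disjoint_sdiff_left

namespace Adm21

variable {D : ℕ → Set (Set (Pt d))} {sT sS : ℕ → ℕ} {k : ℕ} {Ω Λ S : ℕ → Set (Pt d)}

/-- `Ω_{j+1} ⊆ Ω_j` (`1 ≤ j < k`). [cite: Balaban1988Convergent, (2.1) p.254] -/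
theorem Ω_succ_subset_Ω (h : Adm21 D sT sS k Ω Λ S) {j : ℕ} (h1 : 1 ≤ j) (hj : j < k) : Ω (j + 1) ⊆ Ω j :=
  (h.Ω_succ_subset j h1 hj).trans (h.Λ_subset j h1 hj.le)

/-- `Λ_{j+1} ⊆ Λ_j` (`1 ≤ j < k`). [cite: Balaban1988Convergent, (2.1) p.254] -/
theorem Λ_succ_subset_Λ (h : Adm21 D sT sS k Ω Λ S) {j : ℕ} (h1 : 1 ≤ j) (hj : j < k) : Λ (j + 1) ⊆ Λ j :=
  (h.Λ_subset (j + 1) (by omega) (by omega)).trans (h.Ω_succ_subset j h1 hj)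

/-- *"Ω₁ ⊃ Ω₂ ⊃ … ⊃ Ω_k"*: `Ω_{j+n} ⊆ Ω_j` (`1 ≤ j`, `j + n ≤ k`). [cite: Balaban1988Convergent, (2.1) p.254] -/
theorem Ω_add_subset (h : Adm21 D sT sS k Ω Λ S) {j : ℕ} (h1 : 1 ≤ j) : ∀ {n : ℕ}, j + n ≤ k → Ω (j + n) ⊆ Ω j
  | 0, _ => le_rfl
  | n + 1, hn => (h.Ω_succ_subset_Ω (j := j + n) (by omega) (by omega)).trans (h.Ω_add_subset h1 (by omega))

/-- `Λ_{j+n} ⊆ Λ_j` (`1 ≤ j`, `j + n ≤ k`). [cite: Balaban1988Convergent, (2.1) p.254] -/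
theorem Λ_add_subset (h : Adm21 D sT sS k Ω Λ S) {j : ℕ} (h1 : 1 ≤ j) : ∀ {n : ℕ}, j + n ≤ k → Λ (j + n) ⊆ Λ j
  | 0, _ => le_rfl
  | n + 1, hn => (h.Λ_succ_subset_Λ (j := j + n) (by omega) (by omega)).trans (h.Λ_add_subset h1 (by omega))

/-- *"Ω₁ ⊃ Ω₂ ⊃ … ⊃ Ω_k"*: `Ω_{j'} ⊆ Ω_j` for `1 ≤ j ≤ j' ≤ k`. [cite: Balaban1988Convergent, (2.1) p.254] -/
theorem Ω_antitone (h : Adm21 D sT sS k Ω Λ S) {j j' : ℕ} (h1 : 1 ≤ j) (hjj' : j ≤ j') (hj' : j' ≤ k) :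
    Ω j' ⊆ Ω j := by
  obtain ⟨n, rfl⟩ := Nat.exists_eq_add_of_le hjj'
  exact h.Ω_add_subset h1 hj'

/-- `Λ_{j'} ⊆ Λ_j` for `1 ≤ j ≤ j' ≤ k`. [cite: Balaban1988Convergent, (2.1) p.254] -/
theorem Λ_antitone (h : Adm21 D sT sS k Ω Λ S) {j j' : ℕ} (h1 : 1 ≤ j) (hjj' : j ≤ j') (hj' : j' ≤ k) :
    Λ j' ⊆ Λ j := by
  obtain ⟨n, rfl⟩ := Nat.exists_eq_add_of_le hjj'
  exact h.Λ_add_subset h1 hj'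

/-- `Λ_{j'} ⊆ Ω_j` for `1 ≤ j ≤ j' ≤ k` (every later small field region lies in every earlier localization domain).
[cite: Balaban1988Convergent, (2.1) p.254] -/
theorem Λ_subset_Ω_of_le (h : Adm21 D sT sS k Ω Λ S) {j j' : ℕ} (h1 : 1 ≤ j) (hjj' : j ≤ j') (hj' : j' ≤ k) :
    Λ j' ⊆ Ω j :=
  (h.Λ_subset j' (by omega) hj').trans (h.Ω_antitone h1 hjj' hj')

/-- The large field regions increase: `Z_j ⊆ Z_{j'}` for `1 ≤ j ≤ j' ≤ k`. [cite: Balaban1988Convergent, (2.3) p.255] -/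
theorem Z_monotone (h : Adm21 D sT sS k Ω Λ S) {j j' : ℕ} (h1 : 1 ≤ j) (hjj' : j ≤ j') (hj' : j' ≤ k) :
    Z Λ j ⊆ Z Λ j' :=
  Set.compl_subset_compl.mpr (h.Λ_antitone h1 hjj' hj')

/-- `S_j ⊆ Ω_j` and `S_j ⊆ Z_j`. [cite: Balaban1988Convergent, (2.1) p.254] -/
theorem S_subset_Ω_inter_Z (h : Adm21 D sT sS k Ω Λ S) {j : ℕ} (h1 : 1 ≤ j) (hj : j ≤ k) :
    S j ⊆ Ω j ∩ Z Λ j :=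
  h.S_subset j h1 hj

/-- *"If Ω_j ∩ Λ_jᶜ is nonempty, then S_j is nonempty too"* — given a point of `Ω_j` outside `Ω_j^{∼−1}` (print: *"in
fact it contains Ω_j ∖ Ω_j^{∼−1}"*, a non-empty layer for a proper non-empty domain of the torus). [cite: Balaban1988Convergent, §2 p.255] -/
theorem S_nonempty (h : Adm21 D sT sS k Ω Λ S) {j : ℕ} (h1 : 1 ≤ j) (hj : j ≤ k) (hne : (Ω j ∩ (Λ j)ᶜ).Nonempty)
    (hlayer : (Ω j \ innerN (sT j) 1 (Ω j)).Nonempty) : (S j).Nonempty :=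
  hlayer.mono (h.S_layer j h1 hj hne)

/-- The boundary layer and `R_j` split `S_j`: `S_j = (Ω_j ∖ Ω_j^{∼−1}) ∪ R_j` when `Ω_j ∩ Λ_jᶜ ≠ ∅`. [cite: Balaban1988Convergent, §2 p.255] -/
theorem S_eq_layer_union_R (h : Adm21 D sT sS k Ω Λ S) {j : ℕ} (h1 : 1 ≤ j) (hj : j ≤ k)
    (hne : (Ω j ∩ (Λ j)ᶜ).Nonempty) : S j = (Ω j \ innerN (sT j) 1 (Ω j)) ∪ R Ω S sT j := by
  rw [R_eq, Set.union_sdiff_cancel (h.S_layer j h1 hj hne)]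

/-- THE DEGENERATE CASE *"Λ_j = Ω_j … Such a situation may arise as a result of an R-operation"*: with `Λ = Ω` and all
`S_j = ∅`, the sequences are admissible iff `{Ω_j}` is a chain `Ω₁ ⊃ Ω₂ ⊃ … ⊃ Ω_k` in the classes `𝐃_j`. [cite: Balaban1988Convergent, (2.1) p.255] -/
theorem of_eq (D : ℕ → Set (Set (Pt d))) (sT sS : ℕ → ℕ) (k : ℕ) (Ω : ℕ → Set (Pt d))
    (hmem : ∀ j, 1 ≤ j → j ≤ k → Ω j ∈ D j) (hchain : ∀ j, 1 ≤ j → j < k → Ω (j + 1) ⊆ Ω j) :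
    Adm21 D sT sS k Ω Ω (fun _ => ∅) where
  memΩ := hmem
  memΛ := hmem
  Λ_subset _ _ _ := le_rfl
  Ω_succ_subset := hchain
  S_subset _ _ _ := Set.empty_subset _
  S_cubes _ _ _ := fun _ _ _ => Iff.rfl
  S_layer j _ _ hne := by simp at hne

/-- Restriction to a smaller top index `k' ≤ k`. [cite: Balaban1988Convergent, (2.1) p.254] -/
theorem mono_k (h : Adm21 D sT sS k Ω Λ S) {k' : ℕ} (hk : k' ≤ k) : Adm21 D sT sS k' Ω Λ S where
  memΩ j h1 hj := h.memΩ j h1 (hj.trans hk)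
  memΛ j h1 hj := h.memΛ j h1 (hj.trans hk)
  Λ_subset j h1 hj := h.Λ_subset j h1 (hj.trans hk)
  Ω_succ_subset j h1 hj := h.Ω_succ_subset j h1 (by omega)
  S_subset j h1 hj := h.S_subset j h1 (hj.trans hk)
  S_cubes j h1 hj := h.S_cubes j h1 (hj.trans hk)
  S_layer j h1 hj := h.S_layer j h1 (hj.trans hk)

end Adm21

/-- Restriction of the full admissibility to a smaller top index. [cite: Balaban1988Convergent, (2.1)–(2.3) pp.254–255] -/
theorem Admissible.mono_k {D : ℕ → Set (Set (Pt d))} {sT sS sZ : ℕ → ℕ} {k : ℕ} {Ω Λ S : ℕ → Set (Pt d)}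
    (h : Admissible D sT sS sZ k Ω Λ S) {k' : ℕ} (hk : k' ≤ k) : Admissible D sT sS sZ k' Ω Λ S :=
  ⟨h.adm21.mono_k hk, ⟨fun j h1 hj => h.adm23.cond23 j h1 (hj.trans hk)⟩⟩

/-- Non-vacuity: no large fields at all (`Λ_j = Ω_j =` the whole lattice, `S_j = ∅`, `Z_j = ∅`) is admissible for the
classes of unions of cubes. [cite: Balaban1988Convergent, (2.1)–(2.3) pp.254–255] -/
theorem admissible_univ (s sT sS sZ : ℕ → ℕ) (k : ℕ) :
    Admissible (fun j => {X : Set (Pt d) | IsUnionOfCubes (s j) X}) sT sS sZ k (fun _ => Set.univ) (fun _ => Set.univ)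
      (fun _ => ∅) where
  adm21 := Adm21.of_eq _ sT sS k _ (fun j _ _ => fun _ _ _ => Iff.rfl) (fun _ _ _ => le_rfl)
  adm23 := ⟨fun j _ _ => by
    intro a ha
    simp [ZIdx, Z] at ha⟩

end Literature.MathematicalPhysics.QuantumFieldTheory.Balaban1983to89.B14.Eq21Admissible
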